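/-
Copyright: statement-level skeleton of a published paper (lit-balaban cell, Phase-2 proof seat p39 gen 7). No proof claims
beyond what the kernel checks below.
-/
import Literature.MathematicalPhysics.QuantumFieldTheory.Balaban1983to89.B3KernelConvolutionTorus

/-!
# B3 — T. Bałaban, *(Higgs)₂,₃ quantum fields in a finite volume. III. Renormalization*, CMP **88** (1983) 411–445
[Balaban1983Higgs3], p. 441 [PDF 31] with p. 437 [PDF 27]: the TAIL AND BALL RADIAL SUMS behind the sharp lattice convolution estimates
used for *"If at least one propagator G_{j₀}(0) is replaced by G_{j₀}(0)(1 − m²_{j₀} − a_{j₀}P_{j₀})C^ξ, then we get a convergent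
expression"* (the vector self-energy functions Π_{μμ′}, Π_{μμ′ν} of (3.26)–(3.30)) — the `|y − z|^{−4}` tail and the `|y − z|^{−2}`
ball on the `ξ`-lattice torus in `d = 3`, uniformly in the spacing and in the volume

statement-level skeleton of published theorems with citation tags; proofs where landed; nothing here is a claim about
the Yang–Mills mass gap

PDF held: `paper:balaban1983-higgs-2-3-quantum-fields-finite-volume` (journal page = PDF page + 410); pp. 437, 441 read on the
×2 renders `run/shared/lean/pub/pub-balaban/b2b-balaban-ref1/pages/1983-cmp88-higgs23-III/1983-cmp88-higgs23-III-p027-x2.png`,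
`…-p031-x2.png`.  Row **B3.Eq3.25-3.32** of `HOME/lit-balaban-r15/ROWS-B3.md` (fold owner r15): p. 441 [PDF 31] *"Next we replace the
propagator G_{j₀}(0) by C^ξ, ξ = L^{−j₀}, using the same equation as in (3.16). If at least one propagator G_{j₀}(0) is replaced by
G_{j₀}(0)(1 − m²_{j₀} − a_{j₀}P_{j₀})C^ξ, then we get a convergent expression."*; p. 437 [PDF 27]: *"Using the inequalities
|C^ξ(y − y′)| ≦ O(1)e^{−½|y−y′|}/|y − y′|, |G^ξ_{j″}(0; y, y′)| ≦ O(1)e^{−δ₀|y−y′|}/|y − y′|, and the corresponding inequalities for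
derivatives, we can estimate (3.16) by a constant."*  This seat's gen 7 proves the p. 441 sentence for the vector self-energy
functions Π_{μμ′}, Π_{μμ′ν} of (3.26)–(3.30) at the zero-field torus instance; the present file is part of its MODEL-FREE toolkit
(kernels on a torus level `Site P j`, volume element `ξ^d`, `d = 3`, "`p`-profiles" `(ξ·max(1,|y − z|_∞))^{−p}e^{−cξ|y−z|_∞}`,
`|·|_∞` = `supDist` in lattice steps).
* (private) `Σ_{s=R}^{N} s^{−2} ≤ 2/R`; the sum of a function of the sup distance over `{|y − z| ≥ R}` shell by shell.
* **`sum_ge_inv_four_le`**: `Σ_{|y−z| ≥ R} ξ³(ξ|y − z|)^{−4} ≤ 108·ξ^{−1}/R` (`R ≥ 1`; shell count `B3TorusRadialSums.card_shell_le`) —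
  the lattice `∫_{|u| ≥ r}d³u |u|^{−4} = 4π/r`; **`sum_inv_four_le`**: the full regularised sum `Σ_z ξ³(ξ·max(1,|y−z|))^{−4} ≤ 109ξ^{−1}`.
* **`sum_ball_profile_two_le`** (′): `Σ_{|y−z| ≤ 2n} ξ³(ξ·max(1,|y−z|))^{−2} ≤ 735·ξn` (`n ≥ 1`) — the lattice `∫_{|u| ≤ 2r}d³u|u|^{−2} = 8πr`:
  the Riemann radial sum of `B3TorusRadialSums` with the `n`-dependent rate `(2ξn)^{−1}` (on the ball `e^{−|y−z|/2n} ≥ e^{−1}`).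
File 1 of this seat's gen-7 toolkit (2: `B3KernelConvolutionTorusSharp`, 3: `B3KernelConvolutionTorusOneTwo`, 4: `B3KernelBlockSmearing`).
Mathlib + the cited tree files only; theorems only, no definitions, no named facts; standard axioms.  Unit `lit-balaban-p39-g7` (Phase-2 proof seat p39, gen 7),
HOME `run/shared/lean/pub/lit-balaban/`, 2026-08-21.
-/

open scoped BigOperators

namespace Literature.MathematicalPhysics.QuantumFieldTheory.Balaban1983to89.B3TorusRadialTails

open LatticeFieldCalculus B3Sect3ScalarSelfEnergy B3TorusRadialSums B3Bound316 B3KernelConvolutionTorus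

noncomputable section

variable {P : Params} {j : ℕ}

/-! ## 1. One-dimensional and shell sums -/

/-- kernel: `Σ_{s=R}^{N} s^{−2} ≤ 2/R` for `R ≥ 1` (`s^{−2} ≤ (s−1)^{−1} − s^{−1}` telescoped, plus the first term `R^{−2} ≤ R^{−1}`).
[folklore] -/
private theorem sum_Icc_inv_sq_le {R : ℕ} (hR : 1 ≤ R) (N : ℕ) :
    ∑ s ∈ Finset.Icc R N, ((s : ℝ) ^ 2)⁻¹ ≤ 2 / R := by
  have hR0 : (0 : ℝ) < R := by exact_mod_cast hR
  by_cases hN : R ≤ N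
  · -- `Σ_{s=R}^{M} s^{−2} ≤ 2/R − 1/M` by induction on `M ≥ R`
    have key : ∀ M : ℕ, R ≤ M → ∑ s ∈ Finset.Icc R M, ((s : ℝ) ^ 2)⁻¹ ≤ 2 / R - 1 / M := by
      intro M hM
      induction M, hM using Nat.le_induction with
      | base =>
          rw [Finset.Icc_self, Finset.sum_singleton]
          have h1 : ((R : ℝ) ^ 2)⁻¹ ≤ 1 / R := by
            rw [one_div, pow_two, mul_inv]
            have hR1 : (1 : ℝ) ≤ R := by exact_mod_cast hR
            have : (R : ℝ)⁻¹ ≤ 1 := inv_le_one_of_one_le₀ hR1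
            calc (R : ℝ)⁻¹ * (R : ℝ)⁻¹ ≤ (R : ℝ)⁻¹ * 1 :=
                  mul_le_mul_of_nonneg_left this (inv_nonneg.mpr hR0.le)
              _ = (R : ℝ)⁻¹ := mul_one _
          have e : (2 : ℝ) / R - 1 / R = 1 / R := by ring
          linarith
      | succ M hM ih =>
          rw [Finset.sum_Icc_succ_top (by omega)]
          have hM0 : (0 : ℝ) < M := by exact_mod_cast (lt_of_lt_of_le hR hM : 0 < M)
          have hM1 : (0 : ℝ) < (M : ℝ) + 1 := by linarith
          -- `(M+1)^{−2} ≤ M^{−1} − (M+1)^{−1}`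
          have hstep : (((M + 1 : ℕ) : ℝ) ^ 2)⁻¹ ≤ 1 / M - 1 / ((M + 1 : ℕ) : ℝ) := by
            push_cast
            rw [div_sub_div _ _ hM0.ne' hM1.ne', inv_eq_one_div, div_le_div_iff₀ (by positivity) (by positivity)]
            nlinarith
          push_cast at hstep ⊢
          linarith
    have h := key N hN
    have hN0 : (0 : ℝ) ≤ 1 / N := by positivity
    linarith
  · rw [Finset.Icc_eq_empty (by omega), Finset.sum_empty]
    positivity

/-- kernel: a sum over `{z : |y − z|_∞ ≥ R}` (`R ≥ 1`) of a function of the sup distance, shell by shell: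
`Σ_{|y−z| ≥ R} F(|y − z|) = Σ_{s=R}^{n} #shell_s·F(s)` (`n` = sites per direction bounds every distance). [folklore] -/
private theorem sum_filter_ge_eq_sum_shell (y : Site P j) (F : ℕ → ℝ) (R : ℕ) :
    ∑ z ∈ Finset.univ.filter (fun z : Site P j => R ≤ supDist y z), F (supDist y z)
      = ∑ s ∈ Finset.Icc R (P.sitesPerDir j), (shell y s).card * F s := by
  classical
  have hfib : ∀ z ∈ Finset.univ.filter (fun z : Site P j => R ≤ supDist y z),
      supDist y z ∈ Finset.Icc R (P.sitesPerDir j) := by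
    intro z hz
    rw [Finset.mem_filter] at hz
    rw [Finset.mem_Icc]
    refine ⟨hz.2, ?_⟩
    rw [supDist_eq_sup_cdist]
    exact Finset.sup_le fun μ _ => (cdist_le_val _).trans (ZMod.val_le _)
  rw [← Finset.sum_fiberwise_of_maps_to hfib]
  refine Finset.sum_congr rfl fun s hs => ?_
  have hset : (Finset.univ.filter (fun z : Site P j => R ≤ supDist y z)).filter (fun z => supDist y z = s) = shell y s := by
    ext z
    simp only [shell, Finset.mem_filter, Finset.mem_univ, true_and]
    constructor
    · exact fun h => h.2
    · intro h
      rw [Finset.mem_Icc] at hs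
      exact ⟨by omega, h⟩
  rw [hset]
  rw [Finset.sum_congr rfl (g := fun _ => F s) fun i hi => by
    simp only [shell, Finset.mem_filter, Finset.mem_univ, true_and] at hi; rw [hi]]
  rw [Finset.sum_const, nsmul_eq_mul]

/-- **The tail of the `|y − z|^{−4}` sum** (`d = 3`): `Σ_{|y−z|_∞ ≥ R} ξ³(ξ|y − z|_∞)^{−4} ≤ 108·ξ^{−1}/R` for `R ≥ 1` — the shells
`#{|y − z| = s} ≤ 6(2s+1)² ≤ 54s²` give `54ξ^{−1}Σ_{s ≥ R}s^{−2} ≤ 108ξ^{−1}/R`; the lattice form of `∫_{|u| ≥ r}d³u |u|^{−4} = 4π/r`,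
uniformly in the volume. [cite: Balaban1983Higgs3, (3.16) p.437] -/
theorem sum_ge_inv_four_le (hd : P.d = 3) {ξ : ℝ} (hξ : 0 < ξ) (y : Site P j) {R : ℕ} (hR : 1 ≤ R) :
    ∑ z ∈ Finset.univ.filter (fun z : Site P j => R ≤ supDist y z),
        ξ ^ P.d * ((ξ * (supDist y z : ℝ)) ^ 4)⁻¹ ≤ 108 * ξ⁻¹ / R := by
  classical
  have hR0 : (0 : ℝ) < R := by exact_mod_cast hR
  rw [sum_filter_ge_eq_sum_shell y (fun s => ξ ^ P.d * ((ξ * (s : ℝ)) ^ 4)⁻¹) R]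
  have hterm : ∀ s ∈ Finset.Icc R (P.sitesPerDir j),
      ((shell y s).card : ℝ) * (ξ ^ P.d * ((ξ * (s : ℝ)) ^ 4)⁻¹) ≤ 54 * ξ⁻¹ * ((s : ℝ) ^ 2)⁻¹ := by
    intro s hs
    have hs1 : 1 ≤ s := hR.trans (Finset.mem_Icc.mp hs).1
    have hs0 : (0 : ℝ) < s := by exact_mod_cast hs1
    have hs1' : (1 : ℝ) ≤ s := by exact_mod_cast hs1
    have hcard := card_shell_le y hs1
    rw [hd] at hcard
    norm_num at hcard
    -- `hcard : card ≤ 6 (2s+1)²`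
    have h54 : ((shell y s).card : ℝ) ≤ 54 * (s : ℝ) ^ 2 := by nlinarith
    have hval : ξ ^ P.d * ((ξ * (s : ℝ)) ^ 4)⁻¹ = ξ⁻¹ * ((s : ℝ) ^ 4)⁻¹ := by
      rw [hd]; field_simp
    rw [hval]
    have h0 : 0 ≤ ξ⁻¹ * ((s : ℝ) ^ 4)⁻¹ := by positivity
    calc ((shell y s).card : ℝ) * (ξ⁻¹ * ((s : ℝ) ^ 4)⁻¹) ≤ 54 * (s : ℝ) ^ 2 * (ξ⁻¹ * ((s : ℝ) ^ 4)⁻¹) :=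
          mul_le_mul_of_nonneg_right h54 h0
      _ = 54 * ξ⁻¹ * ((s : ℝ) ^ 2)⁻¹ := by field_simp
  calc ∑ s ∈ Finset.Icc R (P.sitesPerDir j), ((shell y s).card : ℝ) * (ξ ^ P.d * ((ξ * (s : ℝ)) ^ 4)⁻¹)
      ≤ ∑ s ∈ Finset.Icc R (P.sitesPerDir j), 54 * ξ⁻¹ * ((s : ℝ) ^ 2)⁻¹ := Finset.sum_le_sum hterm
    _ = 54 * ξ⁻¹ * ∑ s ∈ Finset.Icc R (P.sitesPerDir j), ((s : ℝ) ^ 2)⁻¹ := by rw [Finset.mul_sum]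
    _ ≤ 54 * ξ⁻¹ * (2 / R) := mul_le_mul_of_nonneg_left (sum_Icc_inv_sq_le hR _) (by positivity)
    _ = 108 * ξ⁻¹ / R := by ring

/-- kernel: a site sum split into the diagonal term and the sum over `{|y − z| ≥ 1}`. [folklore] -/
private theorem sum_eq_diag_add_sum_ge_one (y : Site P j) (F : Site P j → ℝ) :
    ∑ z : Site P j, F z = F y + ∑ z ∈ Finset.univ.filter (fun z : Site P j => 1 ≤ supDist y z), F z := by
  classical
  rw [← Finset.add_sum_erase Finset.univ F (Finset.mem_univ y)]
  congr 1
  refine Finset.sum_congr ?_ fun _ _ => rfl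
  ext z
  simp only [Finset.mem_erase, Finset.mem_univ, and_true, Finset.mem_filter, true_and, Nat.one_le_iff_ne_zero,
    ne_eq]
  rw [supDist_eq_zero_iff]
  exact ⟨fun h h' => h h'.symm, fun h h' => h h'.symm⟩

/-- **The full regularised `|y − z|^{−4}` sum** (`d = 3`, `0 < ξ`): `Σ_z ξ³(ξ·max(1,|y − z|_∞))^{−4} ≤ 109·ξ^{−1}` — diagonal term `ξ^{−1}`
plus the tail from `R = 1`. [cite: Balaban1983Higgs3, (3.16) p.437] -/
theorem sum_inv_four_le (hd : P.d = 3) {ξ : ℝ} (hξ : 0 < ξ) (y : Site P j) :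
    ∑ z : Site P j, ξ ^ P.d * ((ξ * max (1 : ℝ) (supDist y z : ℝ)) ^ 4)⁻¹ ≤ 109 * ξ⁻¹ := by
  classical
  rw [sum_eq_diag_add_sum_ge_one y]
  have hdiag : ξ ^ P.d * ((ξ * max (1 : ℝ) (supDist y y : ℝ)) ^ 4)⁻¹ = ξ⁻¹ := by
    rw [max_one_supDist_self, mul_one, hd]; field_simp
  have htail : ∑ z ∈ Finset.univ.filter (fun z : Site P j => 1 ≤ supDist y z),
      ξ ^ P.d * ((ξ * max (1 : ℝ) (supDist y z : ℝ)) ^ 4)⁻¹ ≤ 108 * ξ⁻¹ / (1 : ℕ) := by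
    refine le_trans (le_of_eq ?_) (sum_ge_inv_four_le hd hξ y le_rfl)
    refine Finset.sum_congr rfl fun z hz => ?_
    have h1 : (1 : ℝ) ≤ (supDist y z : ℝ) := by exact_mod_cast (Finset.mem_filter.mp hz).2
    rw [max_eq_right h1]
  rw [hdiag, Nat.cast_one, div_one] at *
  linarith

/-- **The `|y − z|^{−2}` sum over a ball** (`d = 3`, `0 < ξ`, `n ≥ 1`): `Σ_{|y−z|_∞ ≤ 2n} ξ³(ξ·max(1,|y − z|_∞))^{−2} ≤ 735·ξn` —
the lattice form of `∫_{|u| ≤ 2r}d³u |u|^{−2} = 8πr`: the Riemann radial sum of `B3TorusRadialSums` with the rate `(2ξn)^{−1}`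
(on the ball `e^{−|y−z|/2n} ≥ e^{−1}`), diagonal term `ξ ≤ ξn`. [cite: Balaban1983Higgs3, (3.16) p.437] -/
theorem sum_ball_profile_two_le (hd : P.d = 3) {ξ : ℝ} (hξ : 0 < ξ) (y : Site P j) {n : ℕ} (hn : 1 ≤ n) :
    ∑ z ∈ Finset.univ.filter (fun z : Site P j => supDist y z ≤ 2 * n),
        ξ ^ P.d * ((ξ * max (1 : ℝ) (supDist y z : ℝ)) ^ 2)⁻¹ ≤ 735 * (ξ * n) := by
  classical
  have hn0 : (0 : ℝ) < n := by exact_mod_cast hn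
  have hn1 : (1 : ℝ) ≤ n := by exact_mod_cast hn
  set c : ℝ := (2 * (ξ * n))⁻¹ with hc
  have hc0 : 0 < c := by positivity
  -- the weighted full sum off the diagonal
  have hrad := riemann_radial_sum_le y hc0 hξ (κ := 2) (p := 0) (by omega)
  have h2c : 2 / c = 4 * (ξ * n) := by rw [hc]; field_simp; ring
  have hξn : ξ ≤ ξ * n := by nlinarith
  have hradv : (2 : ℝ) * P.d * (3 ^ (P.d - 1) * ((0 : ℕ).factorial * (2 / c) ^ 0) * (ξ + 2 / c)) ≤ 270 * (ξ * n) := by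
    rw [hd, h2c]
    norm_num
    linarith
  -- on the ball the exponential weight is at least `e^{−1}`
  have hball : ∀ z ∈ Finset.univ.filter (fun z : Site P j => supDist y z ≤ 2 * n), z ≠ y →
      ξ ^ P.d * ((ξ * max (1 : ℝ) (supDist y z : ℝ)) ^ 2)⁻¹ ≤
        Real.exp 1 * (ξ ^ P.d * (((ξ * supDist y z) ^ 2)⁻¹ * Real.exp (-(c * (ξ * supDist y z))))) := by
    intro z hz hne
    have hle : (supDist y z : ℝ) ≤ 2 * n := by exact_mod_cast (Finset.mem_filter.mp hz).2
    rw [max_one_supDist_of_ne hne]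
    have hexp : 1 ≤ Real.exp 1 * Real.exp (-(c * (ξ * supDist y z))) := by
      rw [← Real.exp_add]
      apply Real.one_le_exp
      have : c * (ξ * (supDist y z : ℝ)) ≤ 1 := by
        rw [hc]
        calc (2 * (ξ * n))⁻¹ * (ξ * (supDist y z : ℝ)) ≤ (2 * (ξ * n))⁻¹ * (ξ * (2 * n)) :=
              mul_le_mul_of_nonneg_left (mul_le_mul_of_nonneg_left hle hξ.le) (by positivity)
          _ = 1 := by field_simp
      linarith
    have h0 : 0 ≤ ξ ^ P.d * ((ξ * (supDist y z : ℝ)) ^ 2)⁻¹ := by positivity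
    calc ξ ^ P.d * ((ξ * (supDist y z : ℝ)) ^ 2)⁻¹ = ξ ^ P.d * ((ξ * (supDist y z : ℝ)) ^ 2)⁻¹ * 1 := (mul_one _).symm
      _ ≤ ξ ^ P.d * ((ξ * (supDist y z : ℝ)) ^ 2)⁻¹ * (Real.exp 1 * Real.exp (-(c * (ξ * supDist y z)))) :=
          mul_le_mul_of_nonneg_left hexp h0
      _ = _ := by ring
  -- split off the diagonal and enlarge the ball to the whole torus
  have hsplit : ∑ z ∈ Finset.univ.filter (fun z : Site P j => supDist y z ≤ 2 * n),
      ξ ^ P.d * ((ξ * max (1 : ℝ) (supDist y z : ℝ)) ^ 2)⁻¹ =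
      ξ ^ P.d * ((ξ * max (1 : ℝ) (supDist y y : ℝ)) ^ 2)⁻¹ +
        ∑ z ∈ (Finset.univ.filter (fun z : Site P j => supDist y z ≤ 2 * n)).erase y,
          ξ ^ P.d * ((ξ * max (1 : ℝ) (supDist y z : ℝ)) ^ 2)⁻¹ := by
    rw [← Finset.add_sum_erase]
    exact Finset.mem_filter.mpr ⟨Finset.mem_univ _, by rw [(supDist_eq_zero_iff y y).mpr rfl]; exact Nat.zero_le _⟩
  have hdiag : ξ ^ P.d * ((ξ * max (1 : ℝ) (supDist y y : ℝ)) ^ 2)⁻¹ ≤ ξ * n := by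
    rw [max_one_supDist_self, mul_one, hd]
    have : ξ ^ 3 * (ξ ^ 2)⁻¹ = ξ := by field_simp
    rw [this]
    nlinarith
  have hoff : ∑ z ∈ (Finset.univ.filter (fun z : Site P j => supDist y z ≤ 2 * n)).erase y,
      ξ ^ P.d * ((ξ * max (1 : ℝ) (supDist y z : ℝ)) ^ 2)⁻¹ ≤ Real.exp 1 * (270 * (ξ * n)) := by
    calc ∑ z ∈ (Finset.univ.filter (fun z : Site P j => supDist y z ≤ 2 * n)).erase y,
          ξ ^ P.d * ((ξ * max (1 : ℝ) (supDist y z : ℝ)) ^ 2)⁻¹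
        ≤ ∑ z ∈ (Finset.univ.filter (fun z : Site P j => supDist y z ≤ 2 * n)).erase y,
            Real.exp 1 * (ξ ^ P.d * (((ξ * supDist y z) ^ 2)⁻¹ * Real.exp (-(c * (ξ * supDist y z))))) := by
          refine Finset.sum_le_sum fun z hz => ?_
          rw [Finset.mem_erase] at hz
          exact hball z hz.2 hz.1
      _ ≤ ∑ z ∈ Finset.univ.filter (fun z : Site P j => z ≠ y),
            Real.exp 1 * (ξ ^ P.d * (((ξ * supDist y z) ^ 2)⁻¹ * Real.exp (-(c * (ξ * supDist y z))))) := by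
          refine Finset.sum_le_sum_of_subset_of_nonneg ?_ fun z _ _ => by positivity
          intro z hz
          rw [Finset.mem_erase] at hz
          exact Finset.mem_filter.mpr ⟨Finset.mem_univ _, hz.1⟩
      _ = Real.exp 1 * ∑ z ∈ Finset.univ.filter (fun z : Site P j => z ≠ y),
            ξ ^ P.d * (((ξ * supDist y z) ^ 2)⁻¹ * Real.exp (-(c * (ξ * supDist y z)))) := by rw [Finset.mul_sum]
      _ ≤ Real.exp 1 * (270 * (ξ * n)) :=
          mul_le_mul_of_nonneg_left (hrad.trans hradv) (Real.exp_pos 1).le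
  rw [hsplit]
  have he := Real.exp_one_lt_d9
  have h1 := mul_le_mul_of_nonneg_right he.le (show (0 : ℝ) ≤ 270 * (ξ * n) by positivity)
  norm_num at h1
  nlinarith [mul_pos hξ hn0, h1, hdiag, hoff]

/-- The ball sum centred at the second variable. [cite: Balaban1983Higgs3, (3.16) p.437] -/
theorem sum_ball_profile_two_le' (hd : P.d = 3) {ξ : ℝ} (hξ : 0 < ξ) (y : Site P j) {n : ℕ} (hn : 1 ≤ n) :
    ∑ z ∈ Finset.univ.filter (fun z : Site P j => supDist z y ≤ 2 * n),
        ξ ^ P.d * ((ξ * max (1 : ℝ) (supDist z y : ℝ)) ^ 2)⁻¹ ≤ 735 * (ξ * n) := by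
  simp only [supDist_comm _ y]
  exact sum_ball_profile_two_le hd hξ y hn

end

end Literature.MathematicalPhysics.QuantumFieldTheory.Balaban1983to89.B3TorusRadialTails
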